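import Literature.MathematicalPhysics.QuantumFieldTheory.Balaban1983to89.B13Eq210Components

/-!
# `Balaban1983to89.B13Eq29Resummation` — T. Bałaban, *Renormalization group approach to lattice gauge field
theories. II. Cluster expansions*, Commun. Math. Phys. **116** (1988) 1–22, doi:10.1007/bf01239022
[Balaban1988RG2Cluster]: the resummation **(2.9)** p. 14 — *"The equalities (2.4), (2.6), (2.8) imply
(2.1) = Σ_Z H(Z)"* — PROVED for the window geometry as the exchange of the sums over `Z₀` and `Z`

HONEST FRAMING (cell `lit-balaban`, verbatim): statement-level skeleton of published theorems with citation tags; proofs where landed; nothing here is a claim about the Yang–Mills mass gap.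

PDF held: `paper:balaban1988-cmp116-rg-ii-cluster` (journal page = PDF page + 0); pp. 13–14 read from the OCR text
(`lit read … --pages 12-14`) AND p. 14 as an image from
`run/shared/lean/pub/pub-balaban/b2b-balaban-ref1/pages/1988-cmp116-rg-II-cluster/1988-cmp116-rg-II-cluster-p014-x2.png`.

CITATION HEADER (p. 13 [PDF 13], verbatim): *"we take cubes from π_{k+1}, i.e. cubes of the size LM in the scale
corresponding to the lattice T_η. We define σ₀ as the family of such cubes Δ disjoint with the interior of Z̃₀, or
with the interior of Z′₀, where Z′₀ is a union of the smallest family of such cubes containing Z̃₀."*  (p. 12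
[PDF 12], display (2.4): *"(2.1) = Σ_{Z₀} ∫dμ_{C^{(k)}}(B) F(Z₀, B)"*.)  p. 14 [PDF 14], after display (2.8)
`∫dμ₀(X)G(Z₀, X, C^{(k)}(Z₀), (C^{(k)})^{1/2}, Δ_k) = Σ_Z Π_{Δ⊂Z∖Z̃′₀} ∫₀¹ds(Δ) ∂/∂s(Δ) (…) = Σ_Z H(Z, Z₀)`, verbatim:
*"The sums are over Z such, that each connected component of Z contains a component of Z′₀. The equalities (2.4),
(2.6), (2.8) imply*  `(2.1) = Σ_Z H(Z),  where  H(Z) = Σ_{Z₀: Z̃₀⊂Z} H(Z, Z₀).`  (2.9)  *This is the desired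
expansion into localized quantities."*

WHAT IS REPRODUCED (unit `lit-balaban-p25`, generation 2 of the Phase-2 proof seat p25; SKELETON row `B13.Eq2.9`,
knitting `B13.Eq2.8` (upstream, `B13Sect2Statements.display_28_restricted`) with `B13.Eq2.10`/`B13.Eq2.11`
(downstream, `B13Factor210Literal.HsumLit_biUnion`, `B13Eq210Components.sum_HsumLit_eq_sum_polymerFamilies`,
`B13Eq210Components.polymerExpansion_211_window`); HOME `run/shared/lean/pub/lit-balaban/lit-balaban-p25/`).
The content of (2.9) is an EXCHANGE OF TWO FINITE SUMS: (2.4) writes (2.1) as a sum over the families `Z₀`, (2.8)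
writes the `Z₀`-term as a sum over the domains `Z ⊇ Z′₀`, `Z∖Z′₀ ⊆ σ₀`, *"such, that each connected component of Z
contains a component of Z′₀"*, of the localized activities `H(Z, Z₀)`; summing first over `Z` and then over the
`Z₀` admissible for `Z` — «Z̃₀ ⊂ Z» — gives `Σ_Z H(Z)` with `H(Z) = Σ_{Z₀: Z̃₀⊂Z} H(Z, Z₀)`.  Over the tree's
CONCRETE two-scale index geometry (π_k-cubes and π_{k+1}-cubes as lattice indices `Pt d = Fin d → ℤ`, parent map
`B14DomainGeom.cubeIdx L`, window `B` = a finite family of π_{k+1}-cube indices with free boundary — the model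
conventions m1–m6 of `B13Factor210Literal`, none re-declared) this file proves:
(A) `Z̃₀` and `Z′₀` as FINITE families (`ztildeF`, `zprimeF`, with `coe_ztildeF : ↑(ztildeF W) = B14BoxFix.ienl ↑W`
and `coe_zprimeF : ↑(zprimeF L W) = B13Factor210Literal.zprime L W`), `σ₀` inside the window (`sigma0 L B W :=
B ∖ Z′₀`), and the identification of the (2.8) index set: `Z ∈ B13Sect2Statements.domains28 Z′₀ σ₀ ↔ Z′₀ ⊆ Z ⊆ B`
(`mem_domains28_iff`);
(B) **(2.9)**: for EVERY function `T(Z, Z₀)` with values in a commutative semiring,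
`Σ_{Z₀ ∈ families24 L B} Σ_{Z ∈ admDomains28 L B Z₀} T(Z, Z₀) = Σ_{Z ⊆ B} HsumLit L T Z`
(`sum_families24_sum_admDomains28`; `families24 L B` = the families `Z₀` of π_k-cubes of the window whose `Z′₀`
lies in the window, `admDomains28 L B Z₀` = the printed range of (2.8), i.e. `domains28 Z′₀ σ₀` restricted by the
LITERAL admissibility predicate `B13Factor210Literal.AdmLit L Z Z₀` («Z̃₀ ⊂ Z» and *each connected component of Z
contains a component of Z′₀*), `B13Factor210Literal.HsumLit` = the tree's typing of `H(Z) = Σ_{Z₀: Z̃₀⊂Z} H(Z,Z₀)`)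
— the bijection of index pairs `(Z₀, Z)`: `Z₀ ∈ families24 ∧ Z ∈ admDomains28 Z₀ ↔ Z ⊆ B ∧ Z₀ ⊆ fineCubes L Z ∧
AdmLit L Z Z₀`; and the printed sentence itself, `eq29_of_24_28`: IF (2.1) `= Σ_{Z₀} F(Z₀)` (2.4) and
`F(Z₀) = Σ_{Z admissible} H(Z, Z₀)` (2.8) THEN (2.1) `= Σ_{Z ⊆ B} H(Z)`;
(C) composed with (2.8) AS LANDED (`display_28_restricted`, the decoupling expansion with the LM-cubes `σ₀`, for
every function `Φ_{Z₀}` of the parameters `s`, given the (1.10)-vanishing of the non-admissible terms):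
`Σ_{Z₀} Φ_{Z₀}(s(σ₀) = 1) = Σ_{Z ⊆ B} HsumLit L (act28 …) Z` (`eq29`), the activity being the named summand
`B13Sect2Statements.H28` (`act28`);
(D) composed further with (2.10)/(2.11) AS LANDED: under the multiplicativity shape `ActMulLit` of that activity and
the normalization of the empty term, `Σ_{Z₀} Φ_{Z₀}(1) = Σ_{{Z₁,…,Z_n}} Π H(Z_i)` (`eq21_eq_sum_polymerFamilies`) `=
1 + Σ_{n≥1} (1/n!) Σ_{(Z₁,…,Z_n)} Π_{i<j} ζ(Z_i,Z_j) H(Z₁)⋯H(Z_n)` (`eq21_eq_polymerSeries211`, complex activities)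
— the chain (2.4) + (2.8) ⇒ (2.9) ⇒ (2.10) ⇒ (2.11) of p. 14 kernel-knitted over the window model.
NOT ASSERTED: anything analytic — the `Z₀`-terms `Φ_{Z₀}` / activities `H(Z, Z₀)` ((2.4)–(2.8): Gaussian
fluctuation integrals with s-interpolated propagators) are abstract, (2.6) (a change of variables inside each term)
is absorbed in them, the (1.10)-vanishing and the multiplicativity are hypotheses exactly as in `B13Sect2Statements`
/ `B13Factor210Literal`; the window is a finite family of π_{k+1}-indices with free boundary (on the torus of the
paper every `Z₀` has `Z′₀` inside the lattice; here the outer sum runs over the `Z₀` with `Z′₀ ⊆ B`); no new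
`Prop`-valued fact (D-0026).
-/

namespace Literature.MathematicalPhysics.QuantumFieldTheory.Balaban1983to89.B13Eq29Resummation

open Literature.MathematicalPhysics.QuantumFieldTheory.Balaban1983to89.B14DomainGeom
open Literature.MathematicalPhysics.QuantumFieldTheory.Balaban1983to89.B14Components
open Literature.MathematicalPhysics.QuantumFieldTheory.Balaban1983to89.B14BoxFix
open Literature.MathematicalPhysics.QuantumFieldTheory.Balaban1983to89.B13Factor210
open Literature.MathematicalPhysics.QuantumFieldTheory.Balaban1983to89.B13Factor210Literal
open Literature.MathematicalPhysics.QuantumFieldTheory.Balaban1983to89.B13MayerDecoupling (Dop corner Dop_empty)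
open Literature.MathematicalPhysics.QuantumFieldTheory.Balaban1983to89.B13Sect2Statements
  (domains28 H28 display_28_restricted polymerSeries211)
open Literature.MathematicalPhysics.QuantumFieldTheory.Balaban1983to89.B13Eq210Components
  (compsF compsF_pairwise biUnion_compsF polymerFamilies sum_HsumLit_eq_sum_polymerFamilies
    polymerExpansion_211_window zeta)
open Literature.MathematicalPhysics.QuantumFieldTheory.Balaban1983to89.TreeLengthCubeSystem (Dom)

variable {d : ℕ}

/-! ## Part A. `Z̃₀`, `Z′₀` as finite families, `σ₀` inside the window, and the index set of (2.8) -/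

section Enlargements

/-- `Z̃₀` as a FINITE family: the π_k-cubes touching a cube of `Z₀` (*"the tilde over Z₀ concerns M-cubes"*, p. 13;
`□̃ = □̃¹` of [I] p. 257 at index level = the `3^d` indices at sup-distance `≤ 1`) — the finite form of
`B14BoxFix.ienl ↑Z₀` (`coe_ztildeF`). [cite: Balaban1988RG2Cluster, p.13] -/
noncomputable def ztildeF (W : Finset (Pt d)) : Finset (Pt d) :=
  W.biUnion fun r => Fintype.piFinset fun i => Finset.Icc (r i - 1) (r i + 1)

/-- Membership in `Z̃₀`: touching a cube of `Z₀`. [cite: Balaban1988RG2Cluster, p.13] -/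
theorem mem_ztildeF {W : Finset (Pt d)} {c : Pt d} : c ∈ ztildeF W ↔ ∃ r ∈ W, Touching c r := by
  simp only [ztildeF, Finset.mem_biUnion, Fintype.mem_piFinset, Finset.mem_Icc, Touching, abs_sub_le_iff]
  constructor
  · rintro ⟨r, hr, h⟩
    exact ⟨r, hr, fun i => ⟨by linarith [(h i).1, (h i).2], by linarith [(h i).1, (h i).2]⟩⟩
  · rintro ⟨r, hr, h⟩
    exact ⟨r, hr, fun i => ⟨by linarith [(h i).1, (h i).2], by linarith [(h i).1, (h i).2]⟩⟩

/-- `Z̃₀` (finite form) IS the tree's touching-enlargement `B14BoxFix.ienl`. [cite: Balaban1988RG2Cluster, p.13] -/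
theorem coe_ztildeF (W : Finset (Pt d)) : (↑(ztildeF W) : Set (Pt d)) = ienl (↑W : Set (Pt d)) := by
  ext c
  simp only [Finset.mem_coe, mem_ztildeF, ienl, Set.mem_setOf_eq]

variable (L : ℕ)

/-- `Z′₀` as a FINITE family: *"Z′₀ is a union of the smallest family of such cubes* [of π_{k+1}] *containing Z̃₀"*
(p. 13) — the π_{k+1}-cubes `cubeIdx L x` of the π_k-cubes `x` of `Z̃₀`; the finite form of
`B13Factor210Literal.zprime L Z₀` (`coe_zprimeF`). [cite: Balaban1988RG2Cluster, p.13] -/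
noncomputable def zprimeF (W : Finset (Pt d)) : Finset (Pt d) := (ztildeF W).image (cubeIdx L)

/-- `Z′₀` (finite form) IS the tree's `B13Factor210Literal.zprime`. [cite: Balaban1988RG2Cluster, p.13] -/
theorem coe_zprimeF (W : Finset (Pt d)) : (↑(zprimeF L W) : Set (Pt d)) = zprime L W := by
  rw [zprimeF, Finset.coe_image, coe_ztildeF]
  rfl

/-- Membership in the finite `Z′₀` is membership in `zprime`. [cite: Balaban1988RG2Cluster, p.13] -/
theorem mem_zprimeF {W : Finset (Pt d)} {b : Pt d} : b ∈ zprimeF L W ↔ b ∈ zprime L W := by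
  rw [← Finset.mem_coe, coe_zprimeF]

/-- `Z′₀` of the empty family is empty. [cite: Balaban1988RG2Cluster, p.13] -/
theorem zprimeF_empty : zprimeF L (∅ : Finset (Pt d)) = ∅ := by
  simp [zprimeF, ztildeF]

/-- **`σ₀` inside the window `B`**: *"the family of such cubes Δ disjoint with the interior of Z̃₀, or with the
interior of Z′₀"* — the π_{k+1}-cubes of the window not in `Z′₀`. [cite: Balaban1988RG2Cluster, p.13] -/
noncomputable def sigma0 (B W : Finset (Pt d)) : Finset (Pt d) := B \ zprimeF L W

/-- `Z′₀` and `σ₀` are disjoint (the hypothesis `hdisj` of `B13Sect2Statements.display_28`).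
[cite: Balaban1988RG2Cluster, p.13] -/
theorem disjoint_zprimeF_sigma0 (B W : Finset (Pt d)) : Disjoint (zprimeF L W) (sigma0 L B W) :=
  Finset.disjoint_sdiff

/-- `σ₀` of the empty family is the whole window. [cite: Balaban1988RG2Cluster, p.13] -/
theorem sigma0_empty (B : Finset (Pt d)) : sigma0 L B ∅ = B := by
  rw [sigma0, zprimeF_empty, Finset.sdiff_empty]

variable {L}

/-- «Z̃₀ ⊂ Z» forces the π_k-cubes of `Z₀` to lie inside `Z` (`Z₀ ⊆ Z̃₀ ⊆ Z′₀ ⊆ Z`; `L ≥ 1`).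
[cite: Balaban1988RG2Cluster, (2.9) p.14] -/
theorem subset_fineCubes_of_zprime_subset (hL : 0 < L) {Z W : Finset (Pt d)} (h : zprime L W ⊆ ↑Z) :
    W ⊆ fineCubes L Z :=
  fun _ hx => (mem_fineCubes hL).2 (Finset.mem_coe.1 (h (parent_mem_zprime L hx)))

/-- Monotonicity of the family of π_k-cubes inside a family of π_{k+1}-cubes (`L ≥ 1`).
[cite: Balaban1988RG2Cluster, p.13] -/
theorem fineCubes_mono (hL : 0 < L) {Z Z' : Finset (Pt d)} (h : Z ⊆ Z') : fineCubes L Z ⊆ fineCubes L Z' :=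
  fun _ hx => (mem_fineCubes hL).2 (h ((mem_fineCubes hL).1 hx))

/-- An admissible pair has `Z′₀ ⊆ Z` (first clause of `AdmLit`, finite form).
[cite: Balaban1988RG2Cluster, (2.9) p.14] -/
theorem zprimeF_subset_of_admLit {Z W : Finset (Pt d)} (h : AdmLit L Z W) : zprimeF L W ⊆ Z :=
  fun _ hb => Finset.mem_coe.1 (h.1 ((mem_zprimeF L).1 hb))

/-- **The index set of (2.8) in the window**: for `Z′₀ ⊆ B`, a family `Z` is of the form `Z′₀ ∪ σ`,
`σ ⊆ σ₀ = B∖Z′₀` (`B13Sect2Statements.domains28`) iff `Z′₀ ⊆ Z ⊆ B`. [cite: Balaban1988RG2Cluster, (2.8) p.14] -/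
theorem mem_domains28_iff {B W Z : Finset (Pt d)} (hW : zprimeF L W ⊆ B) :
    Z ∈ domains28 (zprimeF L W) (sigma0 L B W) ↔ zprimeF L W ⊆ Z ∧ Z ⊆ B := by
  simp only [domains28, Finset.mem_image, Finset.mem_powerset, sigma0]
  constructor
  · rintro ⟨σ, hσ, rfl⟩
    exact ⟨Finset.subset_union_left, Finset.union_subset hW (hσ.trans Finset.sdiff_subset)⟩
  · rintro ⟨h1, h2⟩
    exact ⟨Z \ zprimeF L W, Finset.sdiff_subset_sdiff h2 le_rfl, Finset.union_sdiff_of_subset h1⟩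

end Enlargements

/-! ## Part B. (2.9): the exchange of the sums over `Z₀` ((2.4)) and `Z` ((2.8)) -/

section Exchange

variable (L : ℕ)

open Classical in
/-- The families `Z₀` of the outer sum (2.4) `(2.1) = Σ_{Z₀} ∫dμ F(Z₀, B)` IN THE WINDOW `B`: finite families of
π_k-cubes inside `B` whose covering family `Z′₀` of π_{k+1}-cubes lies in `B` (on the torus of the paper every `Z₀`
qualifies; any further restriction of the printed range — `Z₀ ∈ 𝐃_k`, *"the smallest localization domain containing
Y₀ and P"*, p. 12 — is absorbed in the summand). [cite: Balaban1988RG2Cluster, (2.4) p.12] -/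
noncomputable def families24 (B : Finset (Pt d)) : Finset (Finset (Pt d)) :=
  (fineCubes L B).powerset.filter fun W => zprimeF L W ⊆ B

variable {L} in
/-- Membership in `families24`. [cite: Balaban1988RG2Cluster, (2.4) p.12] -/
theorem mem_families24 {B W : Finset (Pt d)} :
    W ∈ families24 L B ↔ W ⊆ fineCubes L B ∧ zprimeF L W ⊆ B := by
  classical
  rw [families24, Finset.mem_filter, Finset.mem_powerset]

variable [∀ Z Z₀ : Finset (Pt d), Decidable (AdmLit L Z Z₀)]

/-- **The printed range of the sum over `Z` in (2.8)** for the `Z₀`-term, in the window `B`: the domains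
`Z = Z′₀ ∪ σ`, `σ ⊆ σ₀` (`domains28`) *"such, that each connected component of Z contains a component of Z′₀"* —
the LITERAL admissibility predicate `B13Factor210Literal.AdmLit L Z Z₀`. [cite: Balaban1988RG2Cluster, (2.8) p.14] -/
noncomputable def admDomains28 (B W : Finset (Pt d)) : Finset (Finset (Pt d)) :=
  (domains28 (zprimeF L W) (sigma0 L B W)).filter fun Z => AdmLit L Z W

variable {L}

/-- Membership in the printed range of (2.8): `Z ⊆ B` and `AdmLit L Z Z₀` (which contains «Z̃₀ ⊂ Z»).
[cite: Balaban1988RG2Cluster, (2.8) p.14] -/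
theorem mem_admDomains28 {B W Z : Finset (Pt d)} (hW : zprimeF L W ⊆ B) :
    Z ∈ admDomains28 L B W ↔ Z ⊆ B ∧ AdmLit L Z W := by
  rw [admDomains28, Finset.mem_filter, mem_domains28_iff hW]
  constructor
  · rintro ⟨⟨_, hZB⟩, hA⟩
    exact ⟨hZB, hA⟩
  · rintro ⟨hZB, hA⟩
    exact ⟨⟨zprimeF_subset_of_admLit hA, hZB⟩, hA⟩

/-- **THE BIJECTION OF INDEX PAIRS behind (2.9)**: `(Z₀, Z)` with `Z₀` a family of (2.4) in the window and `Z` in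
the printed range of (2.8) for `Z₀` ↔ `(Z, Z₀)` with `Z ⊆ B` and `Z₀` admissible for `Z` in the sense of (2.9)
(«Z̃₀ ⊂ Z», `Z₀` inside `Z`, each component of `Z` containing a component of `Z′₀`).
[cite: Balaban1988RG2Cluster, (2.9) p.14] -/
theorem mem_families24_and_mem_admDomains28_iff (hL : 0 < L) (B W Z : Finset (Pt d)) :
    W ∈ families24 L B ∧ Z ∈ admDomains28 L B W ↔
      (W ∈ (fineCubes L Z).powerset.filter fun Z₀ => AdmLit L Z Z₀) ∧ Z ∈ B.powerset := by
  rw [mem_families24, Finset.mem_filter, Finset.mem_powerset, Finset.mem_powerset]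
  constructor
  · rintro ⟨⟨_, hW'B⟩, hZ⟩
    obtain ⟨hZB, hA⟩ := (mem_admDomains28 hW'B).1 hZ
    exact ⟨⟨subset_fineCubes_of_zprime_subset hL hA.1, hA⟩, hZB⟩
  · rintro ⟨⟨hWZ, hA⟩, hZB⟩
    have hW'B : zprimeF L W ⊆ B := (zprimeF_subset_of_admLit hA).trans hZB
    exact ⟨⟨hWZ.trans (fineCubes_mono hL hZB), hW'B⟩, (mem_admDomains28 hW'B).2 ⟨hZB, hA⟩⟩

variable {R : Type*} [CommSemiring R]

/-- **(2.9) p. 14 — the exchange of summation**, for EVERY localized activity `T(Z, Z₀)`: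
`Σ_{Z₀} Σ_{Z admissible for Z₀ (2.8)} T(Z, Z₀) = Σ_{Z ⊆ B} H(Z)` with `H(Z) = Σ_{Z₀: Z̃₀⊂Z} T(Z, Z₀)` = the tree's
`B13Factor210Literal.HsumLit L T Z`. [cite: Balaban1988RG2Cluster, (2.9) p.14] -/
theorem sum_families24_sum_admDomains28 (hL : 0 < L) (B : Finset (Pt d))
    (T : Finset (Pt d) → Finset (Pt d) → R) :
    ∑ W ∈ families24 L B, ∑ Z ∈ admDomains28 L B W, T Z W = ∑ Z ∈ B.powerset, HsumLit L T Z := by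
  unfold HsumLit
  exact Finset.sum_comm' fun W Z => mem_families24_and_mem_admDomains28_iff hL B W Z

/-- **(2.9) p. 14, the printed sentence**: *"The equalities (2.4), (2.6), (2.8) imply (2.1) = Σ_Z H(Z), where
H(Z) = Σ_{Z₀: Z̃₀⊂Z} H(Z, Z₀)"* — IF (2.1) `= Σ_{Z₀} F(Z₀)` ((2.4); (2.6) is a change of variables inside `F(Z₀)`)
and each `F(Z₀) = Σ_{Z admissible} H(Z, Z₀)` ((2.8)), THEN (2.1) `= Σ_{Z ⊆ B} HsumLit L H Z`.
[cite: Balaban1988RG2Cluster, (2.9) p.14] -/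
theorem eq29_of_24_28 (hL : 0 < L) (B : Finset (Pt d)) {lhs21 : R} {F : Finset (Pt d) → R}
    {H : Finset (Pt d) → Finset (Pt d) → R} (h24 : lhs21 = ∑ W ∈ families24 L B, F W)
    (h28 : ∀ W ∈ families24 L B, F W = ∑ Z ∈ admDomains28 L B W, H Z W) :
    lhs21 = ∑ Z ∈ B.powerset, HsumLit L H Z := by
  rw [h24, Finset.sum_congr rfl h28, sum_families24_sum_admDomains28 hL B H]

end Exchange

/-! ## Part C. Composition with (2.8) as landed (`B13Sect2Statements.display_28_restricted`) -/

section With28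

variable (L : ℕ) {E : Type*} [CommRing E]

/-- **The localized activity `H(Z, Z₀)` of (2.8)/(2.9) in the window**, for a family `Φ_{Z₀}` of functions of the
decoupling parameters `s(Δ)`, `Δ` a π_{k+1}-cube (the `Z₀`-terms of (2.4) after (2.6), with the s-dependent
operators of p. 13 — abstract here): the named summand `B13Sect2Statements.H28` with `Z′₀ = zprimeF L Z₀` and
`σ₀ = sigma0 L B Z₀`, i.e. `(Π_{Δ∈Z∖Z′₀} ∫₀¹ds(Δ)∂/∂s(Δ)) Φ_{Z₀} |_{s(σ₀∖(Z∖Z′₀))=0}` in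
difference-operator form. [cite: Balaban1988RG2Cluster, (2.8) p.14] -/
noncomputable def act28 (B : Finset (Pt d)) (Φ : Finset (Pt d) → (Pt d → ℝ) → E) (s : Pt d → ℝ)
    (Z W : Finset (Pt d)) : E :=
  H28 (zprimeF L W) (sigma0 L B W) (Φ W) s Z

/-- The activity of the empty pair is the empty `Z₀`-term itself, at `s(σ₀) = s(B) = 0` (no difference operators).
[cite: Balaban1988RG2Cluster, (2.8) p.14] -/
theorem act28_empty (B : Finset (Pt d)) (Φ : Finset (Pt d) → (Pt d → ℝ) → E) (s : Pt d → ℝ) :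
    act28 L B Φ s ∅ ∅ = Φ ∅ (corner B ∅ s) := by
  unfold act28 H28
  rw [sigma0_empty, zprimeF_empty, Finset.sdiff_empty, Dop_empty]

variable [∀ Z Z₀ : Finset (Pt d), Decidable (AdmLit L Z Z₀)]

/-- **(2.4) + (2.8) ⇒ (2.9) over the window**: for every family `Φ_{Z₀}` of functions of the parameters and every
`s`, GIVEN the (1.10)-vanishing of the (2.8)-terms whose `Z` is not admissible (hypothesis `h0`, exactly as in
`display_28_restricted`), the sum over `Z₀` of the undecoupled `Z₀`-terms `Φ_{Z₀}|_{s(σ₀)=1}` equals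
`Σ_{Z ⊆ B} H(Z)`, `H(Z) = Σ_{Z₀: Z̃₀⊂Z} H(Z, Z₀)` (`HsumLit` of the activity `act28`).
[cite: Balaban1988RG2Cluster, (2.9) p.14] -/
theorem eq29 (hL : 0 < L) (B : Finset (Pt d)) (Φ : Finset (Pt d) → (Pt d → ℝ) → E) (s : Pt d → ℝ)
    (h0 : ∀ W ∈ families24 L B, ∀ Z ∈ domains28 (zprimeF L W) (sigma0 L B W),
      ¬ AdmLit L Z W → H28 (zprimeF L W) (sigma0 L B W) (Φ W) s Z = 0) :
    ∑ W ∈ families24 L B, Φ W (corner (sigma0 L B W) (sigma0 L B W) s) =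
      ∑ Z ∈ B.powerset, HsumLit L (act28 L B Φ s) Z := by
  rw [← sum_families24_sum_admDomains28 hL B (act28 L B Φ s)]
  refine Finset.sum_congr rfl fun W hW => ?_
  rw [display_28_restricted (fun Z => AdmLit L Z W) (zprimeF L W) (sigma0 L B W)
    (disjoint_zprimeF_sigma0 L B W) (Φ W) s (h0 W hW)]
  rfl

/-! ## Part D. Composition with (2.10)/(2.11) as landed -/

/-- `H(Z) = Π_{Z_i component of Z} H(Z_i)` ((2.10) as landed, `B13Factor210Literal.HsumLit_biUnion`, for the
component decomposition `B13Eq210Components.compsF`) for the activity `act28`, given its multiplicativity shape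
`ActMulLit` and the normalization of the empty term. [cite: Balaban1988RG2Cluster, (2.10) p.14] -/
theorem HsumLit_act28_eq_prod_compsF (hL : 0 < L) (B : Finset (Pt d)) (Φ : Finset (Pt d) → (Pt d → ℝ) → E)
    (s : Pt d → ℝ) (hact : ActMulLit L (act28 L B Φ s)) (h1 : Φ ∅ (corner B ∅ s) = 1) (Z : Finset (Pt d)) :
    HsumLit L (act28 L B Φ s) Z = ∏ K ∈ compsF Z, HsumLit L (act28 L B Φ s) K := by
  have h0 : act28 L B Φ s ∅ ∅ = 1 := by rw [act28_empty]; exact h1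
  have h := HsumLit_biUnion hL hact h0 id (compsF Z) (compsF_pairwise Z)
  rwa [biUnion_compsF] at h

/-- **(2.4) + (2.8) ⇒ (2.9) ⇒ (2.10) ⇒ first sum of (2.11) over the window**: under the hypotheses of `eq29`, the
multiplicativity shape `ActMulLit` of the activity and the normalization `Φ_∅|_{s=0} = 1` of the empty term,
`Σ_{Z₀} Φ_{Z₀}(1) = Σ_{{Z₁,…,Z_n}} H(Z₁)⋯H(Z_n)` over the pairwise ζ-compatible families of localization domains of
the window (`B13Eq210Components.polymerFamilies`). [cite: Balaban1988RG2Cluster, (2.11) p.14] -/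
theorem eq21_eq_sum_polymerFamilies (hL : 0 < L) (B : Finset (Pt d)) (Φ : Finset (Pt d) → (Pt d → ℝ) → E)
    (s : Pt d → ℝ)
    (h0 : ∀ W ∈ families24 L B, ∀ Z ∈ domains28 (zprimeF L W) (sigma0 L B W),
      ¬ AdmLit L Z W → H28 (zprimeF L W) (sigma0 L B W) (Φ W) s Z = 0)
    (hact : ActMulLit L (act28 L B Φ s)) (h1 : Φ ∅ (corner B ∅ s) = 1) :
    ∑ W ∈ families24 L B, Φ W (corner (sigma0 L B W) (sigma0 L B W) s) =
      ∑ F ∈ polymerFamilies B, ∏ K ∈ F, HsumLit L (act28 L B Φ s) K := by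
  have h0' : act28 L B Φ s ∅ ∅ = 1 := by rw [act28_empty]; exact h1
  rw [eq29 L hL B Φ s h0, sum_HsumLit_eq_sum_polymerFamilies hL hact h0' B]

end With28

section Series

variable (L : ℕ) [∀ Z Z₀ : Finset (Pt d), Decidable (AdmLit L Z Z₀)]

/-- **(2.4) + (2.8) ⇒ (2.9) ⇒ (2.10) ⇒ (2.11), BOTH EQUALITIES, over the window** (complex activities):
`Σ_{Z₀} Φ_{Z₀}(1) = 1 + Σ_{n≥1} (1/n!) Σ_{(Z₁,…,Z_n)} Π_{i<j} ζ(Z_i, Z_j) H(Z₁)⋯H(Z_n)` with the printed hard core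
`ζ` (`B13Eq210Components.zeta B`) on the localization domains of the window and `H = HsumLit` of the activity
`act28` (second equality: `B13Sect2Statements.polymerExpansion_211` via `polymerExpansion_211_window`).
[cite: Balaban1988RG2Cluster, (2.11) p.14] -/
theorem eq21_eq_polymerSeries211 (hL : 0 < L) (B : Finset (Pt d)) (Φ : Finset (Pt d) → (Pt d → ℝ) → ℂ)
    (s : Pt d → ℝ)
    (h0 : ∀ W ∈ families24 L B, ∀ Z ∈ domains28 (zprimeF L W) (sigma0 L B W),
      ¬ AdmLit L Z W → H28 (zprimeF L W) (sigma0 L B W) (Φ W) s Z = 0)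
    (hact : ActMulLit L (act28 L B Φ s)) (h1 : Φ ∅ (corner B ∅ s) = 1) :
    ∑ W ∈ families24 L B, Φ W (corner (sigma0 L B W) (sigma0 L B W) s) =
      polymerSeries211 (zeta B) (fun X : Dom B => HsumLit L (act28 L B Φ s) X.1) := by
  rw [eq29 L hL B Φ s h0, ← polymerExpansion_211_window B (HsumLit L (act28 L B Φ s))]
  exact Finset.sum_congr rfl fun Z _ => HsumLit_act28_eq_prod_compsF L hL B Φ s hact h1 Z

end Series

end Literature.MathematicalPhysics.QuantumFieldTheory.Balaban1983to89.B13Eq29Resummation
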